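import Literature.AlgebraicGeometry.AbelianSchemes.PoincareSheafMulNKernel
import Literature.AlgebraicGeometry.AbelianSchemes.AbelianSchemeConstSubgroupQuotient
import HarnessLib

/-!
# The stabiliser of `(π × 1)^*𝒫` under translations of `Â` is the dual kernel of `π`
# (`poincareStabilizer = dualKernelSet`, HECKE-LINK H2 file (ii), D1/D6 (u4))

Layer `Literature/AlgebraicGeometry/AbelianSchemes`, namespace `Literature.AlgebraicGeometry.AbelianSchemes.AbelianSchemeOver.DualPair`.
Cell `hodgecm-mathlib`; census `B-provers/B-p20/g9/CENSUS-H2-DualPairOfQuotient.v2.B-p20g9.md` §3 (u4) «`K′ = ker(π^∨)`-identification =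
`dualKernelSet = poincareStabilizer`»; (K)/(u4) plan of record (B-plan1 (g14) 21:39:01Z), bridge for (K4)/(K5).  THEOREMS ONLY; over ★ (P-⊗)
`PoincareSheafBiadditive`, ★ (K1) `PoincareSheafMulNKernel`, ★ `AbelianSchemeConstSubgroupQuotient` (`translation`).

Setting: an abelian scheme `A/S` over a reduced locally Noetherian base with a dual pair `D = (Â, 𝒫)` and the unit hypothesis `hD`,
ANY `S`-scheme `Y` with an `S`-morphism `π : Y → A` (for the two-step descent: `Y = A/K`, `π = mulNDesc`), the family
`N₁ := (π × 1_Â)^*𝒫` on `Y ×_S Â`, and a section `k ∈ Â(S)`.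

* §1 plumbing: `whiskerLeft_left_eq_baseChangeToProd` (`(1_A × g) = 1_A × g`), `whiskerRight_left_comp_baseChangeToProd_const`
  (`(π × 1) ≫ (1_A × (Â → S →k Â)) = pr_Y ≫ (π × k)`), `nonempty_iso_unit_iff_of_section` (a line bundle pulled back along a map
  with a section is trivial iff it is);
* §2 `nonempty_pullback_whiskerLeft_iso_pullback_pullbackP` — `(1_Y × t_k)^*N₁ ≅ (π × 1)^*((1_A × t_k)^*𝒫)` (whisker exchange);
* §3 **`nonempty_pullback_whiskerLeft_translation_iso_iff`** — `(1_Y × t_k)^*N₁ ≅ N₁ ⟺ (π × k)^*𝒫 ≅ 𝒪_Y`: `k` STABILISES `N₁` iff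
  `k` lies in the DUAL KERNEL of `π` ([MumfordAV1970] §15 Thm. 1 «`ker f̂`»; for B-p20 (g9)'s (ii): `k ∈ poincareStabilizer ↔ k ∈
  dualKernelSet`).  Road: `t_k = (Â → S →k Â)·𝟙_Â` as `Â`-valued points, ★ (P-⊗) `𝒫_{t_k} ≅ 𝒫_k ⊗ 𝒫` and ★ (K1) cancel the
  invertible `N₁`; `(π × 1)^*(1_A × (Â → S → Â))^*𝒫 = pr_Y^*((π × k)^*𝒫)` dies iff `(π × k)^*𝒫` does (section `(𝟙_Y, ε_Â)` of `pr_Y`).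

HC_CM is proved only modulo the 7 printed citations until rung 0 closes; nothing here is about HC.

## References
* [MumfordAV1970] D. Mumford, *Abelian Varieties* (1970), §8 (pp. 74–75), §13 (p. 125), §15 Thm. 1 (p. 143).
* [MilneAV2008] J. S. Milne, *Abelian Varieties* (v2.00, 2008), I §8 pp. 36–37, I §9.
-/

noncomputable section

universe u

open CategoryTheory CategoryTheory.Limits AlgebraicGeometry MonoidalCategory CartesianMonoidalCategory
open scoped MonObj

-- `Scheme.Modules` / `SheafOfModules` are not reducible (as in Mathlib's `AlgebraicGeometry/Modules/Sheaf.lean`).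
set_option backward.isDefEq.respectTransparency false

namespace Literature.AlgebraicGeometry.AbelianSchemes

namespace AbelianSchemeOver

open Literature.AlgebraicGeometry.Motives Literature.AlgebraicGeometry.AbelianVarieties
  Literature.AlgebraicGeometry.Modules

variable {S : Scheme.{u}} (A : AbelianSchemeOver S)

/-! ## §1 Plumbing -/

/-- `(A ◁ g).left = 1_A × g` for an `S`-endomorphism `g` of `B` (★ `baseChangeToProd` at `T := B`, `f := B → S`).
[cite: MilneAV2008, I §8 pp. 36–37] -/
theorem whiskerLeft_left_eq_baseChangeToProd (B : AbelianSchemeOver S) (g : B.X ⟶ B.X) :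
    (A.X ◁ g).left = A.baseChangeToProd B B.X.hom g.left (Over.w g) := by
  apply pullback.hom_ext
  · calc (A.X ◁ g).left ≫ pullback.fst A.X.hom B.X.hom = ((A.X ◁ g) ≫ fst A.X B.X).left := rfl
      _ = (fst A.X B.X).left := by rw [whiskerLeft_fst]
      _ = pullback.fst A.X.hom B.X.hom := Over.fst_left
      _ = A.baseChangeToProd B B.X.hom g.left (Over.w g) ≫ pullback.fst A.X.hom B.X.hom := (A.baseChangeToProd_fst B _ _ _).symm
  · calc (A.X ◁ g).left ≫ pullback.snd A.X.hom B.X.hom = ((A.X ◁ g) ≫ snd A.X B.X).left := rfl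
      _ = (snd A.X B.X ≫ g).left := by rw [whiskerLeft_snd]
      _ = pullback.snd A.X.hom B.X.hom ≫ g.left := rfl
      _ = A.baseChangeToProd B B.X.hom g.left (Over.w g) ≫ pullback.snd A.X.hom B.X.hom := (A.baseChangeToProd_snd B _ _ _).symm

/-- `(π ▷ B) ≫ (1_A × (B → S →k B)) = pr_Y ≫ (π, k ∘ !)` as morphisms `Y ×_S B → A ×_S B`, for an `S`-morphism `π : Y → A` and a section
`k` of `B`. [cite: MilneAV2008, I §8 pp. 36–37] -/
theorem whiskerRight_left_comp_baseChangeToProd_const (B : AbelianSchemeOver S) {Y : Over S} (π : Y ⟶ A.X) (k : B.Sections) :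
    (π ▷ B.X).left ≫ A.baseChangeToProd B B.X.hom (toUnit B.X ≫ k).left (Over.w _) =
      pullback.fst Y.hom B.X.hom ≫ (lift π (toUnit Y ≫ k)).left := by
  have hk : (toUnit B.X ≫ k).left = B.X.hom ≫ k.left := by rw [Over.comp_left, Over.toUnit_left]
  have hk' : (toUnit Y ≫ k).left = Y.hom ≫ k.left := by rw [Over.comp_left, Over.toUnit_left]
  apply pullback.hom_ext
  · calc ((π ▷ B.X).left ≫ A.baseChangeToProd B B.X.hom (toUnit B.X ≫ k).left (Over.w _)) ≫ pullback.fst A.X.hom B.X.hom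
          = (π ▷ B.X).left ≫ pullback.fst A.X.hom B.X.hom := by rw [Category.assoc, baseChangeToProd_fst]
      _ = ((π ▷ B.X) ≫ fst A.X B.X).left := rfl
      _ = (fst Y B.X ≫ π).left := by rw [whiskerRight_fst]
      _ = pullback.fst Y.hom B.X.hom ≫ π.left := rfl
      _ = pullback.fst Y.hom B.X.hom ≫ (lift π (toUnit Y ≫ k) ≫ fst A.X B.X).left := by rw [lift_fst]
      _ = (pullback.fst Y.hom B.X.hom ≫ (lift π (toUnit Y ≫ k)).left) ≫ pullback.fst A.X.hom B.X.hom := rfl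
  · calc ((π ▷ B.X).left ≫ A.baseChangeToProd B B.X.hom (toUnit B.X ≫ k).left (Over.w _)) ≫ pullback.snd A.X.hom B.X.hom
          = (π ▷ B.X).left ≫ pullback.snd A.X.hom B.X.hom ≫ (toUnit B.X ≫ k).left := by rw [Category.assoc, baseChangeToProd_snd]
      _ = ((π ▷ B.X) ≫ snd A.X B.X).left ≫ (toUnit B.X ≫ k).left := rfl
      _ = (snd Y B.X).left ≫ (toUnit B.X ≫ k).left := by rw [whiskerRight_snd]
      _ = pullback.snd Y.hom B.X.hom ≫ B.X.hom ≫ k.left := by rw [hk]; rfl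
      _ = pullback.fst Y.hom B.X.hom ≫ Y.hom ≫ k.left := by rw [← Category.assoc, ← pullback.condition, Category.assoc]
      _ = pullback.fst Y.hom B.X.hom ≫ (lift π (toUnit Y ≫ k) ≫ snd A.X B.X).left := by rw [lift_snd, hk']
      _ = (pullback.fst Y.hom B.X.hom ≫ (lift π (toUnit Y ≫ k)).left) ≫ pullback.snd A.X.hom B.X.hom := rfl

/-- **A line bundle pulled back along a morphism with a section is trivial iff it is trivial**: for `p : X → Y` with `σ ≫ p = 𝟙`,
`p^*L ≅ 𝒪_X ⟺ L ≅ 𝒪_Y`. [cite: MilneAV2008, I §8 pp. 36–37] -/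
theorem nonempty_iso_unit_iff_of_section {X Y : Scheme.{u}} (p : X ⟶ Y) (σ : Y ⟶ X) (hσ : σ ≫ p = 𝟙 Y) (L : Y.Modules) :
    Nonempty ((Scheme.Modules.pullback p).obj L ≅ SheafOfModules.unit _) ↔ Nonempty (L ≅ SheafOfModules.unit _) := by
  refine ⟨fun ⟨i⟩ => ⟨?_⟩, fun ⟨i⟩ => ⟨(Scheme.Modules.pullback p).mapIso i ≪≫ RigidifiedLineBundle.pullbackUnitIso p⟩⟩
  exact ((Scheme.Modules.pullbackId (X := Y)).app L).symm ≪≫ (Scheme.Modules.pullbackCongr hσ.symm).app L ≪≫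
    ((Scheme.Modules.pullbackComp σ p).app L).symm ≪≫ (Scheme.Modules.pullback σ).mapIso i ≪≫
    RigidifiedLineBundle.pullbackUnitIso σ

variable {A}

namespace DualPair

variable (D : A.DualPair) {Y : Over S} (π : Y ⟶ A.X) (k : D.hat.Sections)

/-! ## §2 `(1_Y × t_k)^*N₁ ≅ (π × 1)^*𝒫_{t_k}` -/

/-- **`(1_Y × t_k)^*((π × 1)^*𝒫) ≅ (π × 1)^*((1_A × t_k)^*𝒫)`** by whisker exchange `(Y ◁ t_k) ≫ (π ▷ Â) = (π ▷ Â) ≫ (A ◁ t_k)`;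
`(1_A × t_k)^*𝒫 = 𝒫_{t_k}` is the family classified by the `Â`-valued point `t_k` of `Â`. [cite: MilneAV2008, I §8 pp. 36–37] -/
theorem nonempty_pullback_whiskerLeft_iso_pullback_pullbackP (g : D.hat.X ⟶ D.hat.X) :
    Nonempty ((Scheme.Modules.pullback (Y ◁ g).left).obj ((Scheme.Modules.pullback (π ▷ D.hat.X).left).obj D.P) ≅
      (Scheme.Modules.pullback (π ▷ D.hat.X).left).obj (D.pullbackP D.hat.X.hom g.left (Over.w g))) := by
  have h : (Y ◁ g).left ≫ (π ▷ D.hat.X).left =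
      (π ▷ D.hat.X).left ≫ A.baseChangeToProd D.hat D.hat.X.hom g.left (Over.w g) := by
    rw [← A.whiskerLeft_left_eq_baseChangeToProd D.hat g, ← Over.comp_left, whisker_exchange, Over.comp_left]
  exact ⟨(Scheme.Modules.pullbackComp _ _).app D.P ≪≫ (Scheme.Modules.pullbackCongr h).app D.P ≪≫
    ((Scheme.Modules.pullbackComp _ _).app D.P).symm⟩

/-- `(π × 1)^*𝒫_{𝟙_Â} ≅ (π × 1)^*𝒫 = N₁`. [cite: MilneAV2008, I §8 pp. 36–37] -/
theorem nonempty_pullback_pullbackP_id_iso :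
    Nonempty ((Scheme.Modules.pullback (π ▷ D.hat.X).left).obj
        (D.pullbackP D.hat.X.hom ((𝟙 D.hat.X : Over.mk D.hat.X.hom ⟶ D.hat.X)).left (Over.w _)) ≅
      (Scheme.Modules.pullback (π ▷ D.hat.X).left).obj D.P) :=
  (nonempty_pullbackP_id_iso D).map fun i => (Scheme.Modules.pullback _).mapIso i

/-- `(π × 1)^*(1_A × (Â → S →k Â))^*𝒫 ≅ pr_Y^*((π × k)^*𝒫)`. [cite: MilneAV2008, I §8 pp. 36–37] -/
theorem nonempty_pullback_pullbackP_const_iso :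
    Nonempty ((Scheme.Modules.pullback (π ▷ D.hat.X).left).obj
        (D.pullbackP D.hat.X.hom ((toUnit D.hat.X ≫ k : Over.mk D.hat.X.hom ⟶ D.hat.X)).left (Over.w _)) ≅
      (Scheme.Modules.pullback (pullback.fst Y.hom D.hat.X.hom)).obj
        ((Scheme.Modules.pullback (lift π (toUnit Y ≫ k)).left).obj D.P)) :=
  ⟨(Scheme.Modules.pullbackComp _ _).app D.P ≪≫
    (Scheme.Modules.pullbackCongr (A.whiskerRight_left_comp_baseChangeToProd_const D.hat π k)).app D.P ≪≫
    ((Scheme.Modules.pullbackComp _ _).app D.P).symm⟩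

/-! ## §3 Stabiliser = dual kernel -/

variable [IsReduced S] [IsLocallyNoetherian S]

/-- **`k` STABILISES `N₁ = (π × 1)^*𝒫` IFF `k` LIES IN THE DUAL KERNEL OF `π`**: for `S` reduced and locally Noetherian, the unit
hypothesis `hD`, any `S`-morphism `π : Y → A` and any section `k ∈ Â(S)`,
`(1_Y × t_k)^*N₁ ≅ N₁ ⟺ (π × k)^*𝒫 ≅ 𝒪_Y` — for the two-step descent of B-p20 (g9) (`Y = A/K`, `π = mulNDesc`,
`N₁ = poincarePullback`, ★ `poincarePullback_eq`): `k ∈ poincareStabilizer ↔ k ∈ dualKernelSet`.  With ★ (K2) the stabiliser is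
therefore inside `Â[n]` whenever `ψ ≫ π = [n]_A`. [cite: MumfordAV1970, §15 Thm. 1 (p. 143)] [cite: MilneAV2008, I §9] -/
theorem nonempty_pullback_whiskerLeft_translation_iso_iff
    (hD : Nonempty ((Scheme.Modules.pullback (unitHatSlice D)).obj D.P ≅ SheafOfModules.unit _)) :
    Nonempty ((Scheme.Modules.pullback (Y ◁ D.hat.translation k).left).obj
        ((Scheme.Modules.pullback (π ▷ D.hat.X).left).obj D.P) ≅
      (Scheme.Modules.pullback (π ▷ D.hat.X).left).obj D.P) ↔
    Nonempty ((Scheme.Modules.pullback (lift π (toUnit Y ≫ k)).left).obj D.P ≅ SheafOfModules.unit _) := by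
  -- typed copies of the three `Â`-valued points of `Â`: `t_k`, `𝟙_Â`, `(Â → S →k Â)`; `t_k = (Â → S → Â)·𝟙_Â`
  set tk : Over.mk D.hat.X.hom ⟶ D.hat.X := D.hat.translation k with htk
  set i1 : Over.mk D.hat.X.hom ⟶ D.hat.X := 𝟙 D.hat.X with hi1
  set ck : Over.mk D.hat.X.hom ⟶ D.hat.X := toUnit D.hat.X ≫ k with hck
  have ht : tk * i1⁻¹ = ck := mul_inv_cancel_right ck i1
  -- the section `(𝟙_Y, ε_Â ∘ !)` of `pr_Y : Y ×_S Â → Y`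
  have hsec : pullback.lift (𝟙 Y.left) (Y.hom ≫ D.hat.unitSection)
      (by rw [Category.id_comp, Category.assoc, D.hat.unitSection_comp_hom, Category.comp_id]) ≫
        pullback.fst Y.hom D.hat.X.hom = 𝟙 _ := pullback.lift_fst _ _ _
  obtain ⟨e₁⟩ := D.nonempty_pullback_whiskerLeft_iso_pullback_pullbackP π (D.hat.translation k)
  obtain ⟨e₂⟩ := D.nonempty_pullback_pullbackP_id_iso π
  obtain ⟨e₃⟩ := D.nonempty_pullback_pullbackP_const_iso π k
  rw [← nonempty_iso_unit_iff_of_section (pullback.fst Y.hom D.hat.X.hom) _ hsec]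
  constructor
  · -- stabiliser ⇒ dual kernel: ★ (K1) cancels `N₁`
    rintro ⟨i⟩
    obtain ⟨j⟩ := D.nonempty_pullback_pullbackP_mul_inv_iso_unit D.hat.X.hom hD tk i1 (π ▷ D.hat.X).left
      ⟨e₁.symm ≪≫ i ≪≫ e₂.symm⟩
    rw [D.pullbackP_congr D.hat.X.hom (congrArg Over.Hom.left ht) (Over.w _) (Over.w _)] at j
    exact ⟨e₃.symm ≪≫ j⟩
  · -- dual kernel ⇒ stabiliser: ★ (P-⊗) `𝒫_{t_k} ≅ 𝒫_k ⊗ 𝒫_𝟙`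
    rintro ⟨i⟩
    obtain ⟨m⟩ := D.nonempty_pullbackP_mul_iso hD D.hat.X.hom ck i1
    have hc : D.pullbackP D.hat.X.hom (ck * i1).left (Over.w _) = D.pullbackP D.hat.X.hom tk.left (Over.w _) :=
      D.pullbackP_congr _ rfl _ _
    rw [hc] at m
    refine ⟨e₁ ≪≫ (Scheme.Modules.pullback _).mapIso m ≪≫
      pullbackTensorIso _ (HasRank.isFiniteLocallyFree' (D.hasRank_one_pullbackP _ _ (Over.w _)))
        (HasRank.isFiniteLocallyFree' (D.hasRank_one_pullbackP _ _ (Over.w _))) ≪≫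
      tensorMapIso (e₃ ≪≫ i) e₂ ≪≫ tensorUnitLeftIso _⟩

end DualPair

end AbelianSchemeOver

end Literature.AlgebraicGeometry.AbelianSchemes

end
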